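import Literature.Probability.LatticeModels.CoarseCellMixingDefectsClusterTerm
import Literature.Probability.LatticeModels.CoarseCellMixingDefectsFarChains
import HarnessLib

/-!
# Coarse-cell mixing with defects: the root step for a general multi-cell observable

Companion ("theorems only") file of the coarse-cell defect series. The decay theorem
(`CoarseCellMixingDefectsDecay.influence_decay_markov_defects`) bounds the boundary influence on
SINGLE-cell observables; a general `[0,1]`-valued observable `f` of finitely many cells `Δf` is
reduced to that by one more expansion around the bad cluster attached to the seed `Δf` (no cube,
no finite-size condition): on the event that all cells of `Δf` are good, the vanishing chain rule
`multiCell_influence_adm`; off it, near cluster shapes by `clusterTerm_influence_le` (core `∅`)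
and far ones by `measureReal_farEvent_le`. The result (`root_influence_le`) is

`|γ_Λ f(ζ) - γ_Λ f(ζ')| ≤ Σ_{y ∈ Δf} δ y + Σ_{K near, K ≠ ∅} 2 q^{|K|} Σ_{y ∈ R_K} δ y
   + 2 |Δf| · 2q ((3^d+1)^2 q)^{D-2}`

for the volume `Λ` of sites whose cell is not in `Δg`, ANY two boundary conditions (the frozen
cells are exactly the cells of `Δg`, so every pair is `Δg`-admissible), `Δf` at coarse distance
`≥ D ≥ 2` from `Δg`, and any single-cell influence bound `δ` valid for `Δg`-admissible pairs.

## References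

* R. L. Dobrushin, S. B. Shlosman (1985), §2; J. van den Berg, C. Maes, Ann. Probab. 22 (1994), §2.
-/

noncomputable section

open _root_.MeasureTheory
open scoped ENNReal

namespace Literature.Probability.LatticeModels

variable {d : ℕ} {μc : Fin d → ℕ} {V S : Type*} [MeasurableSpace S]

omit [MeasurableSpace S] in
/-- **Partition of unity by the bad cluster attached to a seed**: for every configuration,
`1_{all seed cells good} + 1_{the bad cluster leaves U} + Σ_{K nonempty shape ⊆ U} 1_{badCluster = K} = 1`.
[folklore] -/
theorem indicator_partition_badCluster (good : CoarseIdx μc → Set (V → S))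
    (Sd U : Finset (CoarseIdx μc)) (σ : V → S) :
    {τ : V → S | ∀ y ∈ Sd, τ ∈ good y}.indicator (1 : (V → S) → ℝ) σ +
      {τ : V → S | ¬ badCluster good 1 Finset.univ Sd τ ⊆ U}.indicator 1 σ +
      ∑ K ∈ (clusterShapes 1 Finset.univ Sd).filter (fun K => K.Nonempty ∧ K ⊆ U),
        (clusterEvent good Sd K).indicator 1 σ = 1 := by
  classical
  set K₀ := badCluster good 1 Finset.univ Sd σ with hK₀
  set G : Set (V → S) := {τ | ∀ y ∈ Sd, τ ∈ good y} with hGdef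
  set Far : Set (V → S) := {τ | ¬ badCluster good 1 Finset.univ Sd τ ⊆ U} with hFardef
  set 𝒩 := (clusterShapes 1 Finset.univ Sd).filter (fun K => K.Nonempty ∧ K ⊆ U) with h𝒩
  have hG_iff : σ ∈ G ↔ K₀ = ∅ := by
    rw [hK₀, badCluster_eq_empty_iff]
    simp [hGdef]
  by_cases h0 : K₀ = ∅
  · have hσG : σ ∈ G := hG_iff.2 h0
    have hσFar : σ ∉ Far := by simp [hFardef, ← hK₀, h0]
    have hsum : ∑ K ∈ 𝒩, (clusterEvent good Sd K).indicator (1 : (V → S) → ℝ) σ = 0 := by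
      refine Finset.sum_eq_zero fun K hK => ?_
      have hne := (Finset.mem_filter.1 hK).2.1
      have hσK : σ ∉ clusterEvent good Sd K := fun hσK => by
        have : K₀ = K := hσK
        exact hne.ne_empty (this ▸ h0)
      simp [hσK]
    simp [hσG, hσFar, hsum]
  · have hσG : σ ∉ G := fun hσG => h0 (hG_iff.1 hσG)
    by_cases hU' : K₀ ⊆ U
    · have hσFar : σ ∉ Far := by simp [hFardef, ← hK₀, hU']
      have hK₀𝒩 : K₀ ∈ 𝒩 := Finset.mem_filter.2
        ⟨badCluster_mem_clusterShapes good 1 Finset.univ Sd σ, Finset.nonempty_iff_ne_empty.2 h0, hU'⟩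
      have hsum : ∑ K ∈ 𝒩, (clusterEvent good Sd K).indicator (1 : (V → S) → ℝ) σ = 1 := by
        rw [Finset.sum_eq_single_of_mem K₀ hK₀𝒩]
        · have : σ ∈ clusterEvent good Sd K₀ := rfl
          simp [this]
        · intro K _ hKK₀
          have hσK : σ ∉ clusterEvent good Sd K := fun hσK => hKK₀ (Eq.symm hσK)
          simp [hσK]
      simp [hσG, hσFar, hsum]
    · have hσFar : σ ∈ Far := hU'
      have hsum : ∑ K ∈ 𝒩, (clusterEvent good Sd K).indicator (1 : (V → S) → ℝ) σ = 0 := by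
        refine Finset.sum_eq_zero fun K hK => ?_
        have hKU := (Finset.mem_filter.1 hK).2.2
        have hσK : σ ∉ clusterEvent good Sd K := fun hσK => by
          have : K₀ = K := hσK
          exact hU' (this ▸ hKU)
        simp [hσK]
      simp [hσG, hσFar, hsum]

/-- **The root step for a general multi-cell observable (block-Markov case).** See the module
docstring. [folklore] -/
theorem root_influence_le [Fintype V] [DecidableEq V] {cell : V → CoarseIdx μc}
    {γ : Specification V S} (hγ : IsSpecification γ) {good : CoarseIdx μc → Set (V → S)}
    (hgl : ∀ (c : CoarseIdx μc) (σ τ : V → S), (∀ v, cell v = c → σ v = τ v) →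
      (σ ∈ good c ↔ τ ∈ good c))
    (hgm : ∀ c, MeasurableSet (good c)) {r : ℝ} (hBL : HasBlockLeak cell γ 0 r)
    {q : ℝ} (hq : 0 ≤ q) (hq2 : ((3 : ℝ) ^ d + 1) ^ 2 * q ≤ 1 / 2)
    (hUKP : UniformKernelPeierls cell γ good q)
    (Δf Δg : Finset (CoarseIdx μc)) {D : ℕ} (hD : 2 ≤ D)
    (hfar : ∀ x ∈ Δf, ∀ y ∈ Δg, D ≤ cdist x y)
    {δ : CoarseIdx μc → ℝ} (hδ : ∀ y, 0 ≤ δ y)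
    (hR : ∀ (Λ : Finset V), (∀ v w, cell v = cell w → v ∈ Λ → w ∈ Λ) →
      ∀ (y : CoarseIdx μc) (g : (V → S) → ℝ), Measurable g → (∀ σ, 0 ≤ g σ ∧ g σ ≤ 1) →
      DependsOn g {v | cell v = y} →
      ∀ ζ ζ' : V → S, AdmRegion cell good Δg Λ ζ ζ' →
        |∫ σ, g σ ∂(γ Λ ζ) - ∫ σ, g σ ∂(γ Λ ζ')| ≤ δ y)
    (ζ ζ' : V → S) (f : (V → S) → ℝ) (hfm : Measurable f) (hf01 : ∀ σ, 0 ≤ f σ ∧ f σ ≤ 1)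
    (hfdep : DependsOn f {v | cell v ∈ Δf}) :
    |∫ σ, f σ ∂(γ (Finset.univ.filter fun v => cell v ∉ Δg) ζ) -
        ∫ σ, f σ ∂(γ (Finset.univ.filter fun v => cell v ∉ Δg) ζ')| ≤
      ∑ y ∈ Δf, δ y +
      ∑ K ∈ (clusterShapes 1 Finset.univ Δf).filter
          (fun K => K.Nonempty ∧ K ⊆ Finset.univ.filter fun c : CoarseIdx μc => ∀ g ∈ Δg, 2 ≤ cdist c g),
        2 * q ^ K.card *
          ∑ y ∈ (((Δf ∪ fatten Finset.univ (∅ ∪ K) 1) \ (∅ ∪ K)).filter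
              (fun c => ∀ v, cell v = c → v ∈ Finset.univ.filter fun v => cell v ∉ Δg)), δ y +
      2 * (Δf.card * (2 * q * (((3 : ℝ) ^ d + 1) ^ 2 * q) ^ (D - 2))) := by
  classical
  set Λ : Finset V := Finset.univ.filter fun v => cell v ∉ Δg with hΛdef
  set U : Finset (CoarseIdx μc) := Finset.univ.filter fun c : CoarseIdx μc => ∀ g ∈ Δg, 2 ≤ cdist c g
    with hUdef
  set 𝒩 := (clusterShapes 1 Finset.univ Δf).filter (fun K => K.Nonempty ∧ K ⊆ U) with h𝒩def
  set Rg : Finset (CoarseIdx μc) → Finset (CoarseIdx μc) := fun K =>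
    (((Δf ∪ fatten Finset.univ (∅ ∪ K) 1) \ (∅ ∪ K))).filter (fun c => ∀ v, cell v = c → v ∈ Λ)
    with hRgdef
  have hmemΛ : ∀ v, v ∈ Λ ↔ cell v ∉ Δg := fun v => by simp [hΛdef]
  have hmemU : ∀ c, c ∈ U ↔ ∀ g ∈ Δg, 2 ≤ cdist c g := fun c => by simp [hUdef]
  have hΛ : ∀ v w, cell v = cell w → v ∈ Λ → w ∈ Λ := fun v w hvw hv => by
    rw [hmemΛ] at hv ⊢; rwa [← hvw]
  -- every boundary pair is `Δg`-admissible for `Λ`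
  have hadm : AdmRegion cell good Δg Λ ζ ζ' := fun v hv hF => by
    rw [hmemΛ] at hv; exact absurd (not_not.1 hv) hF
  -- cells off `Δg` are `Λ`-cells; cells of `Δf` are off `Δg`
  have hcellΛ : ∀ c : CoarseIdx μc, c ∉ Δg → ∀ v, cell v = c → v ∈ Λ := fun c hc v hv => by
    rw [hmemΛ, hv]; exact hc
  have hΔfΔg : ∀ c ∈ Δf, c ∉ Δg := fun c hc hcg => by
    have := hfar c hc c hcg; rw [cdist_self] at this; omega
  haveI := hγ.isProbability Λ ζ
  haveI := hγ.isProbability Λ ζ'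
  -- the pieces of the decomposition
  set G : Set (V → S) := {σ | ∀ y ∈ Δf, σ ∈ good y} with hGdef
  have hGmeas : MeasurableSet G := by
    have : G = ⋂ y ∈ Δf, good y := by ext σ; simp [hGdef]
    rw [this]; exact Finset.measurableSet_biInter Δf fun y _ => hgm y
  set Far : Set (V → S) := {σ | ¬ badCluster good 1 Finset.univ Δf σ ⊆ U} with hFardef
  set E : Finset (CoarseIdx μc) → Set (V → S) := fun K => clusterEvent good Δf K with hEdef
  have hEmeas : ∀ K ∈ 𝒩, MeasurableSet (E K) := fun K hK =>
    measurableSet_clusterEvent hgm (mem_clusterShapes.1 (Finset.mem_filter.1 hK).1).2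
  have hFar_eq : Far = ⋃ K ∈ (clusterShapes 1 Finset.univ Δf).filter (fun K => ¬ K ⊆ U),
      clusterEvent good Δf K := by
    ext σ
    simp only [hFardef, Set.mem_setOf_eq, Set.mem_iUnion, Finset.mem_filter, clusterEvent,
      exists_prop]
    constructor
    · intro hσ
      exact ⟨_, ⟨badCluster_mem_clusterShapes good 1 Finset.univ Δf σ, hσ⟩, rfl⟩
    · rintro ⟨K, ⟨-, hKU⟩, hK⟩
      rwa [hK]
  have hFarmeas : MeasurableSet Far := by
    rw [hFar_eq]
    refine Finset.measurableSet_biUnion _ fun K hK => ?_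
    exact measurableSet_clusterEvent hgm (mem_clusterShapes.1 (Finset.mem_filter.1 hK).1).2
  have hpart : ∀ σ, G.indicator (1 : (V → S) → ℝ) σ + Far.indicator 1 σ +
      ∑ K ∈ 𝒩, (E K).indicator 1 σ = 1 := fun σ =>
    indicator_partition_badCluster good Δf U σ
  have hf1 : ∀ σ, |f σ| ≤ 1 := fun σ => by rw [abs_of_nonneg (hf01 σ).1]; exact (hf01 σ).2
  -- integrability helpers
  have hint : ∀ (η : V → S) (T : Set (V → S)), MeasurableSet T →
      Integrable (fun σ => f σ * T.indicator 1 σ) (γ Λ η) := by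
    intro η T hT
    haveI := hγ.isProbability Λ η
    refine DobrushinMetric.integrable_of_abs_le' (hfm.mul (measurable_const.indicator hT)) (M := 1)
      fun σ => ?_
    rw [abs_mul]
    have h2 : |T.indicator (1 : (V → S) → ℝ) σ| ≤ 1 := by
      by_cases hσ : σ ∈ T <;> simp [hσ]
    nlinarith [abs_nonneg (f σ), abs_nonneg (T.indicator (1 : (V → S) → ℝ) σ), hf1 σ]
  -- the decomposition of `∫ f`
  have hdecomp : ∀ η : V → S, ∫ σ, f σ ∂(γ Λ η) =
      ∫ σ, f σ * G.indicator 1 σ ∂(γ Λ η) + ∫ σ, f σ * Far.indicator 1 σ ∂(γ Λ η) +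
        ∑ K ∈ 𝒩, ∫ σ, f σ * (E K).indicator 1 σ ∂(γ Λ η) := by
    intro η
    haveI := hγ.isProbability Λ η
    have hpt : ∀ σ, f σ = f σ * G.indicator 1 σ + f σ * Far.indicator 1 σ +
        ∑ K ∈ 𝒩, f σ * (E K).indicator 1 σ := fun σ => by
      rw [← Finset.mul_sum]
      have := hpart σ
      linear_combination -(f σ) * this
    have hI1 := hint η G hGmeas
    have hI2 := hint η Far hFarmeas
    have hI3 : Integrable (fun σ => ∑ K ∈ 𝒩, f σ * (E K).indicator 1 σ) (γ Λ η) :=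
      integrable_finsetSum 𝒩 fun K hK => hint η (E K) (hEmeas K hK)
    have hI12 : Integrable (fun σ => f σ * G.indicator 1 σ + f σ * Far.indicator 1 σ) (γ Λ η) :=
      hI1.add hI2
    have e0 : (fun σ => f σ) = fun σ => f σ * G.indicator 1 σ + f σ * Far.indicator 1 σ +
        ∑ K ∈ 𝒩, f σ * (E K).indicator 1 σ := funext hpt
    calc ∫ σ, f σ ∂(γ Λ η)
        = ∫ σ, f σ * G.indicator 1 σ + f σ * Far.indicator 1 σ +
            ∑ K ∈ 𝒩, f σ * (E K).indicator 1 σ ∂(γ Λ η) := by rw [e0]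
      _ = ∫ σ, f σ * G.indicator 1 σ ∂(γ Λ η) + ∫ σ, f σ * Far.indicator 1 σ ∂(γ Λ η) +
            ∫ σ, ∑ K ∈ 𝒩, f σ * (E K).indicator 1 σ ∂(γ Λ η) := by
          rw [integral_add hI12 hI3, integral_add hI1 hI2]
      _ = _ := by rw [integral_finsetSum 𝒩 fun K hK => hint η (E K) (hEmeas K hK)]
  -- (T1) the good term
  have hT1 : |∫ σ, f σ * G.indicator 1 σ ∂(γ Λ ζ) - ∫ σ, f σ * G.indicator 1 σ ∂(γ Λ ζ')| ≤
      ∑ y ∈ Δf, δ y := by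
    set H : (V → S) → ℝ := fun σ => f σ * G.indicator 1 σ with hH
    have hHm : Measurable H := hfm.mul (measurable_const.indicator hGmeas)
    have hH01 : ∀ σ, 0 ≤ H σ ∧ H σ ≤ 1 := fun σ => by
      by_cases hσ : σ ∈ G <;> simp [hH, hσ, (hf01 σ).1, (hf01 σ).2]
    have hGloc : ∀ σ τ : V → S, (∀ v, cell v ∈ Δf → σ v = τ v) → (σ ∈ G ↔ τ ∈ G) := fun σ τ hστ => by
      simp only [hGdef, Set.mem_setOf_eq]
      exact forall₂_congr fun y hy => hgl y σ τ fun v hv => hστ v (hv ▸ hy)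
    have hHdep : DependsOn H {v | cell v ∈ Δf} := fun σ τ hστ => by
      have e1 : f σ = f τ := hfdep hστ
      have e2 : σ ∈ G ↔ τ ∈ G := hGloc σ τ fun v hv => hστ v hv
      simp only [hH, e1]
      by_cases hσ : σ ∈ G
      · simp [Set.indicator_of_mem hσ, Set.indicator_of_mem (e2.1 hσ)]
      · simp [Set.indicator_of_notMem hσ, Set.indicator_of_notMem (fun h' => hσ (e2.2 h'))]
    have hH0 : ∀ σ, (∃ y ∈ Δf, σ ∉ good y) → H σ = 0 := by
      rintro σ ⟨y, hy, hσy⟩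
      have hσ : σ ∉ G := fun hσ => hσy (hσ y hy)
      simp [hH, hσ]
    exact multiCell_influence_adm hγ hgl Δg hδ hR Δf Λ hΛ (fun y hy => hcellΛ y (hΔfΔg y hy)) H hHm
      hH01 hHdep hH0 ζ ζ' hadm
  -- (T2) the far term
  have hT2 : |∫ σ, f σ * Far.indicator 1 σ ∂(γ Λ ζ) - ∫ σ, f σ * Far.indicator 1 σ ∂(γ Λ ζ')| ≤
      2 * (Δf.card * (2 * q * (((3 : ℝ) ^ d + 1) ^ 2 * q) ^ (D - 2))) := by
    have hone : ∀ η : V → S, |∫ σ, f σ * Far.indicator 1 σ ∂(γ Λ η)| ≤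
        Δf.card * (2 * q * (((3 : ℝ) ^ d + 1) ^ 2 * q) ^ (D - 2)) := by
      intro η
      haveI := hγ.isProbability Λ η
      have h1 : |∫ σ, f σ * Far.indicator 1 σ ∂(γ Λ η)| ≤ (γ Λ η).real Far := by
        refine (abs_integral_le_integral_abs).trans ?_
        have hle : ∀ σ, |f σ * Far.indicator (1 : (V → S) → ℝ) σ| ≤ Far.indicator 1 σ := by
          intro σ
          by_cases hσ : σ ∈ Far
          · simp only [Set.indicator_of_mem hσ, Pi.one_apply, mul_one]
            exact hf1 σ
          · simp [hσ]
        calc ∫ σ, |f σ * Far.indicator 1 σ| ∂(γ Λ η) ≤ ∫ σ, Far.indicator 1 σ ∂(γ Λ η) :=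
              integral_mono (hint η Far hFarmeas).abs ((integrable_const (1 : ℝ)).indicator hFarmeas)
                hle
          _ = (γ Λ η).real Far := integral_indicator_one hFarmeas
      refine h1.trans ?_
      refine measureReal_farEvent_le hγ hq hq2 hUKP Λ hΛ η U Δf (fun c hc => ?_)
        (fun c hc c' hcc' => ?_) (fun s hs t ⟨c, hcU, htc⟩ => ?_)
      · rw [hmemU]; intro g hg; have := hfar c hc g hg; omega
      · left
        refine hcellΛ c' fun hc'g => ?_
        have := (hmemU c).1 hc c' hc'g
        omega
      · have hcU' : ¬ ∀ g ∈ Δg, 2 ≤ cdist c g := fun h => hcU ((hmemU c).2 h)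
        push Not at hcU'
        obtain ⟨g, hg, hcg⟩ := hcU'
        have h1 := hfar s hs g hg
        have h2 : cdist s g ≤ cdist s t + cdist t g := cdist_triangle _ _ _
        have h3 : cdist t g ≤ cdist t c + cdist c g := cdist_triangle _ _ _
        omega
    calc |∫ σ, f σ * Far.indicator 1 σ ∂(γ Λ ζ) - ∫ σ, f σ * Far.indicator 1 σ ∂(γ Λ ζ')|
        ≤ |∫ σ, f σ * Far.indicator 1 σ ∂(γ Λ ζ)| + |∫ σ, f σ * Far.indicator 1 σ ∂(γ Λ ζ')| :=
          abs_sub _ _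
      _ ≤ _ := by have := hone ζ; have := hone ζ'; linarith
  -- (T3) the near cluster terms
  have hT3 : ∀ K ∈ 𝒩, |∫ σ, f σ * (E K).indicator 1 σ ∂(γ Λ ζ) -
      ∫ σ, f σ * (E K).indicator 1 σ ∂(γ Λ ζ')| ≤ 2 * q ^ K.card * ∑ y ∈ Rg K, δ y := by
    intro K hK
    obtain ⟨hKsh, hKne, hKU⟩ := Finset.mem_filter.1 hK
    have hKshape := (mem_clusterShapes.1 hKsh).2
    have hres := clusterTerm_influence_le hγ hgl hgm hBL hq hUKP Δg hδ hR Λ hΛ ζ ζ' hadm ∅ Δf K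
      hKshape (fun c ⟨k, hk, hkc⟩ hcg => ?_) hΔfΔg (fun c hc => hcellΛ c (hΔfΔg c hc))
      (fun c _ _ ⟨p, hp, _⟩ _ => absurd hp (Finset.notMem_empty p)) f hfm hf1 hfdep
    · have e : 2 * (1 : ℝ) * q ^ K.card = 2 * q ^ K.card := by ring
      rw [e] at hres
      simpa [hRgdef] using hres
    · rcases Finset.mem_union.1 hk with h | h
      · exact Finset.notMem_empty k h
      · have := (hmemU k).1 (hKU h) c hcg
        omega
  -- assemble
  rw [hdecomp ζ, hdecomp ζ']
  have hsum3 : |∑ K ∈ 𝒩, ∫ σ, f σ * (E K).indicator 1 σ ∂(γ Λ ζ) -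
      ∑ K ∈ 𝒩, ∫ σ, f σ * (E K).indicator 1 σ ∂(γ Λ ζ')| ≤
      ∑ K ∈ 𝒩, 2 * q ^ K.card * ∑ y ∈ Rg K, δ y := by
    rw [← Finset.sum_sub_distrib]
    exact (Finset.abs_sum_le_sum_abs _ _).trans (Finset.sum_le_sum hT3)
  calc |∫ σ, f σ * G.indicator 1 σ ∂(γ Λ ζ) + ∫ σ, f σ * Far.indicator 1 σ ∂(γ Λ ζ) +
          ∑ K ∈ 𝒩, ∫ σ, f σ * (E K).indicator 1 σ ∂(γ Λ ζ) -
        (∫ σ, f σ * G.indicator 1 σ ∂(γ Λ ζ') + ∫ σ, f σ * Far.indicator 1 σ ∂(γ Λ ζ') +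
          ∑ K ∈ 𝒩, ∫ σ, f σ * (E K).indicator 1 σ ∂(γ Λ ζ'))|
      = |(∫ σ, f σ * G.indicator 1 σ ∂(γ Λ ζ) - ∫ σ, f σ * G.indicator 1 σ ∂(γ Λ ζ')) +
          (∫ σ, f σ * Far.indicator 1 σ ∂(γ Λ ζ) - ∫ σ, f σ * Far.indicator 1 σ ∂(γ Λ ζ')) +
          (∑ K ∈ 𝒩, ∫ σ, f σ * (E K).indicator 1 σ ∂(γ Λ ζ) -
            ∑ K ∈ 𝒩, ∫ σ, f σ * (E K).indicator 1 σ ∂(γ Λ ζ'))| := by ring_nf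
    _ ≤ |∫ σ, f σ * G.indicator 1 σ ∂(γ Λ ζ) - ∫ σ, f σ * G.indicator 1 σ ∂(γ Λ ζ')| +
          |∫ σ, f σ * Far.indicator 1 σ ∂(γ Λ ζ) - ∫ σ, f σ * Far.indicator 1 σ ∂(γ Λ ζ')| +
          |∑ K ∈ 𝒩, ∫ σ, f σ * (E K).indicator 1 σ ∂(γ Λ ζ) -
            ∑ K ∈ 𝒩, ∫ σ, f σ * (E K).indicator 1 σ ∂(γ Λ ζ')| :=
        (abs_add_le _ _).trans (add_le_add (abs_add_le _ _) le_rfl)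
    _ ≤ ∑ y ∈ Δf, δ y + 2 * (Δf.card * (2 * q * (((3 : ℝ) ^ d + 1) ^ 2 * q) ^ (D - 2))) +
          ∑ K ∈ 𝒩, 2 * q ^ K.card * ∑ y ∈ Rg K, δ y := add_le_add (add_le_add hT1 hT2) hsum3
    _ = _ := by ring

end Literature.Probability.LatticeModels
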